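import Mathlib
import Literature.NumberTheory.Transcendental.GammaFields
import Summits.Schanuel.Schanuel.Theorems.RigidCoreAclSubsetLogFreeCoreCaseIIMonomials

/-!
# Case II core, file 5: semi-invariant exponential polynomials are monomials
(helper file for the registered stub `stub_caseII_core` of line `eac-extends-core-automorphisms`,
crux stmt-Schanuel-0968 `Summit.Schanuel.Schanuel.Theses.RigidCore.AclSubsetLogFreeCore`)

Same setting as file 4 (`…CaseIIMonomials`), plus an exponential automorphism `θ` of `E` which
stabilises `k`, `Y'` and `Y''`, and the hypothesis (Mono) that no positive iterate of `θ` fixes an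
exponential monomial `c * exp y` with `c ∈ kˣ` and `y ∈ Y'' ∖ Y'`.

* **`subsingleton_of_semiInvariant`** — if an exponential sum `Z = Σ q j * exp (y j)` (pairwise
  inequivalent exponents in `Y''`, non-zero coefficients in `k`) is SEMI-INVARIANT,
  `θ Z = (c * exp y) * Z`, then it has at most one term: matching `θ Z` with `(c·exp y) Z` term by
  term gives a permutation `π` of the terms with `θ (term j) = w * term (π j)`; iterating to the order
  of `π`, the ratio of two distinct terms would be a fixed monomial, against (Mono).
-/

noncomputable section

set_option linter.dupNamespace false

open Set
open scoped BigOperators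
open Literature.ModelTheory.ExponentialFields Literature.ModelTheory.ExponentialFields.ExponentialRing
open Literature.NumberTheory.Transcendental Literature.NumberTheory.Transcendental.GammaField

namespace Summit.Schanuel.Schanuel.Theorems.RigidCore

namespace CaseIICore

variable {E : Type*} [Field E] [CharZero E] [ExponentialRing E]

omit [CharZero E] [ExponentialRing E] in
/-- Iterating a twisted relation: if `θ (f j) = w * f (π j)` for all `j` then
`θ^[n] (f j) = wₙ * f (πⁿ j)` for some `wₙ` with `wₙ ≠ 0` (when `w ≠ 0`). [folklore] -/
theorem exists_iterate_eq_mul_perm (θ : E ≃+* E) {ι : Type*} (f : ι → E) (π : Equiv.Perm ι)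
    {w : E} (hw : w ≠ 0) (h : ∀ j, θ (f j) = w * f (π j)) (n : ℕ) :
    ∃ wn : E, wn ≠ 0 ∧ ∀ j, θ^[n] (f j) = wn * f ((π ^ n) j) := by
  induction n with
  | zero => exact ⟨1, one_ne_zero, fun j => by simp⟩
  | succ n ih =>
    obtain ⟨wn, hwn, hn⟩ := ih
    refine ⟨θ wn * w, mul_ne_zero (by rwa [map_ne_zero_iff θ θ.injective]) hw, fun j => ?_⟩
    rw [Function.iterate_succ_apply', hn, map_mul, h, pow_succ', Equiv.Perm.mul_apply, mul_assoc]

open Classical in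
/-- **Semi-invariant exponential sums have at most one term.**  Let `Z = Σ_j q j * exp (y j)` be an
exponential sum with exponents in `Y''` pairwise inequivalent modulo `Y'` and non-zero coefficients in
`k`, and suppose `θ Z = (c * exp y₀) * Z` for some `c ∈ kˣ`, `y₀ ∈ Y''`, where the exponential
automorphism `θ` stabilises `k`, `Y'`, `Y''` and no positive iterate of `θ` fixes a monomial
`c' * exp y'` with `c' ∈ kˣ`, `y' ∈ Y'' ∖ Y'` (Mono). Then the index type has at most one element.
[folklore] -/
theorem subsingleton_of_semiInvariant (k : Subfield E) {Y' Y'' : Submodule ℚ E} {p : ℕ} (b : Fin p → E)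
    (hbspan : ∀ y ∈ Y'', ∃ r : Fin p → ℚ, y - ∑ i, r i • b i ∈ Y')
    (hblin : ∀ r : Fin p → ℚ, (∑ i, r i • b i) ∈ Y' → r = 0)
    (hexpY' : ∀ y ∈ Y', exp y ∈ k)
    (hAI : ∀ N : ℕ, 0 < N → AlgebraicIndependent k (fun i => exp ((1 / (N : ℚ)) • b i)))
    (θ : E ≃+* E) (hθexp : ∀ x, θ (exp x) = exp (θ x))
    (hθk : ∀ z, z ∈ k ↔ θ z ∈ k) (hθY' : ∀ y, y ∈ Y' ↔ θ y ∈ Y') (hθY'' : ∀ y, y ∈ Y'' ↔ θ y ∈ Y'')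
    (hMono : ∀ n : ℕ, 0 < n → ∀ c ∈ k, c ≠ 0 → ∀ y ∈ Y'', y ∉ Y' → θ^[n] (c * exp y) ≠ c * exp y)
    {ι : Type*} [Fintype ι] (y : ι → E) (hy : ∀ j, y j ∈ Y'')
    (hineq : ∀ j₁ j₂, j₁ ≠ j₂ → y j₁ - y j₂ ∉ Y')
    (q : ι → E) (hq : ∀ j, q j ∈ k) (hq0 : ∀ j, q j ≠ 0)
    {c y₀ : E} (hc : c ∈ k) (hc0 : c ≠ 0) (hy₀ : y₀ ∈ Y'')
    (hsemi : θ (∑ j, q j * exp (y j)) = (c * exp y₀) * ∑ j, q j * exp (y j)) :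
    ∀ j₁ j₂ : ι, j₁ = j₂ := by
  -- the two expansions of `θ Z`
  have hlhs : θ (∑ j, q j * exp (y j)) = ∑ j, θ (q j) * exp (θ (y j)) := by
    rw [map_sum]
    exact Finset.sum_congr rfl fun j _ => by rw [map_mul, hθexp]
  have hrhs : (c * exp y₀) * ∑ j, q j * exp (y j) = ∑ j, (c * q j) * exp (y₀ + y j) := by
    rw [Finset.mul_sum]
    exact Finset.sum_congr rfl fun j _ => by rw [exp_add]; ring
  have heq : ∑ j, θ (q j) * exp (θ (y j)) = ∑ j, (c * q j) * exp (y₀ + y j) := by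
    rw [← hlhs, hsemi, hrhs]
  -- hypotheses of the matching lemma
  have hθy : ∀ j, θ (y j) ∈ Y'' := fun j => (hθY'' _).1 (hy j)
  have hθineq : ∀ j₁ j₂, j₁ ≠ j₂ → θ (y j₁) - θ (y j₂) ∉ Y' := fun j₁ j₂ hne h =>
    hineq j₁ j₂ hne ((hθY' _).2 (by rwa [map_sub]))
  have hθq : ∀ j, θ (q j) ∈ k := fun j => (hθk _).1 (hq j)
  have hθq0 : ∀ j, θ (q j) ≠ 0 := fun j => by rw [map_ne_zero_iff θ θ.injective]; exact hq0 j
  have hy₀y : ∀ j, y₀ + y j ∈ Y'' := fun j => Y''.add_mem hy₀ (hy j)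
  have hineq' : ∀ j₁ j₂, j₁ ≠ j₂ → (y₀ + y j₁) - (y₀ + y j₂) ∉ Y' := fun j₁ j₂ hne h =>
    hineq j₁ j₂ hne (by rwa [add_sub_add_left_eq_sub] at h)
  have hcq : ∀ j, c * q j ∈ k := fun j => mul_mem hc (hq j)
  -- the matching `π` and the twisted relation `θ (term j) = w * term (π j)`
  have hmatch := fun j => exists_match_of_sum_exp_eq k b hbspan hblin hexpY' hAI
    (fun j => θ (y j)) hθy hθineq (fun j => θ (q j)) hθq hθq0
    (fun j => y₀ + y j) hy₀y hineq' (fun j => c * q j) hcq heq j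
  choose π hπY hπeq using hmatch
  have hπinj : Function.Injective π := by
    intro j₁ j₂ h12
    by_contra hne
    apply hθineq j₁ j₂ hne
    have h1 := hπY j₁
    have h2 := hπY j₂
    rw [h12] at h1
    have := Y'.sub_mem h2 h1
    rwa [sub_sub_sub_cancel_left] at this
  have hπbij : Function.Bijective π := Finite.injective_iff_bijective.1 hπinj
  set σ : Equiv.Perm ι := Equiv.ofBijective π hπbij with hσ
  set w : E := c * exp y₀ with hw
  have hw0 : w ≠ 0 := mul_ne_zero hc0 (exp_ne_zero _)
  have hterm : ∀ j, θ (q j * exp (y j)) = w * (q (σ j) * exp (y (σ j))) := by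
    intro j
    rw [map_mul, hθexp, hπeq j, hw, exp_add]
    simp only [hσ, Equiv.ofBijective_apply]
    ring
  -- iterate to the order of `σ`
  set m := orderOf σ with hm
  have hmpos : 0 < m := orderOf_pos σ
  obtain ⟨wm, hwm0, hwm⟩ := exists_iterate_eq_mul_perm θ (fun j => q j * exp (y j)) σ hw0 hterm m
  rw [pow_orderOf_eq_one] at hwm
  simp only [Equiv.Perm.one_apply] at hwm
  -- two distinct terms would give a fixed monomial
  intro j₁ j₂
  by_contra hne
  have hratio : θ^[m] ((q j₁ / q j₂) * exp (y j₁ - y j₂)) = (q j₁ / q j₂) * exp (y j₁ - y j₂) := by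
    have hiter : ∀ n : ℕ, ∃ ψ : E ≃+* E, ∀ x, ψ x = θ^[n] x := by
      intro n
      induction n with
      | zero => exact ⟨RingEquiv.refl E, fun x => rfl⟩
      | succ n ih =>
        obtain ⟨ψ, hψ⟩ := ih
        exact ⟨ψ.trans θ, fun x => by rw [RingEquiv.trans_apply, hψ, Function.iterate_succ_apply']⟩
    obtain ⟨ψ, hψ⟩ := hiter m
    have e1 : (q j₁ / q j₂) * exp (y j₁ - y j₂) = (q j₁ * exp (y j₁)) / (q j₂ * exp (y j₂)) := by
      rw [sub_eq_add_neg, exp_add, exp_neg_eq_inv]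
      field_simp
    rw [e1, ← hψ, map_div₀, hψ, hψ, hwm j₁, hwm j₂, mul_div_mul_left _ _ hwm0]
  have hqq : q j₁ / q j₂ ∈ k := div_mem (hq j₁) (hq j₂)
  have hqq0 : q j₁ / q j₂ ≠ 0 := div_ne_zero (hq0 j₁) (hq0 j₂)
  exact hMono m hmpos _ hqq hqq0 _ (Y''.sub_mem (hy j₁) (hy j₂)) (hineq j₁ j₂ hne) hratio

end CaseIICore

/-! ### Registered helper (crux stub list of stmt-Schanuel-0968) -/

/-- **Registered form of `CaseIICore.subsingleton_of_semiInvariant`** (all binders explicit):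
semi-invariant exponential sums have at most one term, under (Mono). [folklore] -/
theorem caseII_subsingleton_of_semiInvariant {E : Type*} [Field E] [CharZero E] [ExponentialRing E]
    (k : Subfield E) {Y' Y'' : Submodule ℚ E} {p : ℕ} (b : Fin p → E)
    (hbspan : ∀ y ∈ Y'', ∃ r : Fin p → ℚ, y - ∑ i, r i • b i ∈ Y')
    (hblin : ∀ r : Fin p → ℚ, (∑ i, r i • b i) ∈ Y' → r = 0)
    (hexpY' : ∀ y ∈ Y', exp y ∈ k)
    (hAI : ∀ N : ℕ, 0 < N → AlgebraicIndependent k (fun i => exp ((1 / (N : ℚ)) • b i)))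
    (θ : E ≃+* E) (hθexp : ∀ x, θ (exp x) = exp (θ x))
    (hθk : ∀ z, z ∈ k ↔ θ z ∈ k) (hθY' : ∀ y, y ∈ Y' ↔ θ y ∈ Y') (hθY'' : ∀ y, y ∈ Y'' ↔ θ y ∈ Y'')
    (hMono : ∀ n : ℕ, 0 < n → ∀ c ∈ k, c ≠ 0 → ∀ y ∈ Y'', y ∉ Y' → θ^[n] (c * exp y) ≠ c * exp y)
    {ι : Type*} [Fintype ι] (y : ι → E) (hy : ∀ j, y j ∈ Y'')
    (hineq : ∀ j₁ j₂, j₁ ≠ j₂ → y j₁ - y j₂ ∉ Y')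
    (q : ι → E) (hq : ∀ j, q j ∈ k) (hq0 : ∀ j, q j ≠ 0)
    {c y₀ : E} (hc : c ∈ k) (hc0 : c ≠ 0) (hy₀ : y₀ ∈ Y'')
    (hsemi : θ (∑ j, q j * exp (y j)) = (c * exp y₀) * ∑ j, q j * exp (y j)) :
    ∀ j₁ j₂ : ι, j₁ = j₂ :=
  CaseIICore.subsingleton_of_semiInvariant k b hbspan hblin hexpY' hAI θ hθexp hθk hθY' hθY'' hMono y hy
    hineq q hq hq0 hc hc0 hy₀ hsemi

end Summit.Schanuel.Schanuel.Theorems.RigidCore
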